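import Literature.NumberTheory.LFunctions.NoRealZeroCertificateReplaySegment
import HarnessLib

/-!
# Kernel replay of the Lu–Zaman–Zhao certificates: segmented row checks with a three-piece Euler criterion

Topic `Literature/NumberTheory/LFunctions`. The kernel row checkers of the replay (`pick`/`pick2`,
`NoRealZeroCertificateReplay.lean`, `…Fast.lean`) evaluate the Kronecker symbol `(D/p)` by Euler's
criterion `a^{(p−1)/2} mod p` with the exponent split into TWO base-256 pieces (`eulerCode`), which keeps
every intermediate number below `2^9728` for `p < 2^19`. The deep heavy tiers of the `q ≤ 4·10⁵` campaign
need primes up to `5.9·10⁶`: there the high piece `a^{⌊p/512⌋}` is a `2·10⁵`-bit number and the kernel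
cost per prime term quadruples (measured on the farm, 2026-08-26: 2.0 ms/term at `p ≈ 4.5·10⁶` against
0.45 ms/term at `p ≈ 2·10⁶`). This file adds the THREE-piece split

* `eulerCode3 a p` — `e = ⌊p/2⌋ = 65536·q₂ + 256·q₁ + q₀`, all intermediates `< p^256 ≤ 2^5888` for
  `p < 2^23`, with `eulerCode3_eq : eulerCode3 a p = a^{⌊p/2⌋} mod p` (so it agrees with `eulerCode`);
* `pick3`, `rowSumK3`, `rowSearch3`, `checkRowFromK3` — the selectors / prefix accumulator / stop-test
  search / final-segment check of `NoRealZeroCertificateReplaySegment.lean` with `eulerCode3` inside, each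
  proved EQUAL to its two-piece counterpart (`pick3_eq`, `rowSumK3_eq`, `rowSearch3_eq`, `checkRowFromK3_eq`);
* `rowSumK3_append_eq` and **`certifiedAt_of_checkRowFromK3`** — the same composition law and the same
  soundness statement as for `rowSumK` / `checkRowFromK` (`TableValid (S ++ T) → rowSumK3 … S 0 = acc →
  checkRowFromK3 T … acc = true → CertifiedAt (1/5) D`), obtained by rewriting along the equalities.

Measured: 38 400 prime terms at `p ≈ 4.2–4.9·10⁶` in 23 s with `eulerCode3` against 81 s with `eulerCode`
(farm, `decide +kernel`). Definitions and theorems only; nothing is evaluated here; standard axioms.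

## References

* W. Lu, A. Zaman, K. Zhao, *Dirichlet L-functions of quadratic characters have no exceptional
  zeros for moduli up to 10¹⁰*, Math. Comp. (2026), arXiv:2602.03626, §2.1–§3 and (2.5). [LuZamanZhao2026]
* H. L. Montgomery, R. C. Vaughan, *Multiplicative Number Theory I*, CUP 2007, §9.3 (Euler's criterion).
  [MontgomeryVaughan2007]
-/

namespace Literature.NumberTheory.LFunctions
namespace LuZamanZhao2026
namespace Replay

open Literature.Analysis.ValidatedNumerics Literature.Analysis.ValidatedNumerics.NumericsMP

/-! ## Euler's criterion in three exponent pieces -/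

/-- Euler's criterion code of `(a/p)` for an odd prime `p`, `a^{⌊p/2⌋} mod p`, computed with the exponent
`e = ⌊p/2⌋` split as `65536·⌊e/65536⌋ + 256·(⌊e/256⌋ mod 256) + (e mod 256)` and a reduction `mod p`
after every step, so that for `p < 2^23` no intermediate number exceeds `p^256 ≤ 2^5888`.
[cite: MontgomeryVaughan2007, §9.3] -/
def eulerCode3 (a p : ℕ) : ℕ :=
  ((((a ^ (p / 2 / 65536) % p) ^ 256 % p) * (a ^ (p / 2 / 256 % 256) % p) % p) ^ 256 % p) *
    (a ^ (p / 2 % 256) % p) % p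

/-- The inner two pieces give `a^{⌊⌊p/2⌋/256⌋} mod p`. [cite: MontgomeryVaughan2007, §9.3] -/
private theorem eulerCode3_inner (a p : ℕ) :
    ((a ^ (p / 2 / 65536) % p) ^ 256 % p) * (a ^ (p / 2 / 256 % 256) % p) % p = a ^ (p / 2 / 256) % p := by
  rw [← Nat.pow_mod, ← Nat.mul_mod, ← Nat.pow_mul, ← Nat.pow_add]
  congr 2
  omega

/-- **`eulerCode3 a p = a^{⌊p/2⌋} mod p`** (hence `= eulerCode a p`). [cite: MontgomeryVaughan2007, §9.3] -/
theorem eulerCode3_eq (a p : ℕ) : eulerCode3 a p = a ^ (p / 2) % p := by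
  unfold eulerCode3
  rw [eulerCode3_inner, ← Nat.pow_mod, ← Nat.mul_mod, ← Nat.pow_mul, ← Nat.pow_add]
  congr 2
  omega

/-- `eulerCode3` agrees with the two-piece `eulerCode`. [cite: MontgomeryVaughan2007, §9.3] -/
theorem eulerCode3_eq_eulerCode (a p : ℕ) : eulerCode3 a p = eulerCode a p := by
  rw [eulerCode3_eq, eulerCode_eq]

/-! ## The selectors and walks with `eulerCode3` -/

/-- `pick2` with `eulerCode3`: the table value selected for `D = ±Dabs` at the entry `e`.
[cite: MontgomeryVaughan2007, §9.3] -/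
def pick3 (neg : Bool) (Dabs : ℕ) (e : PRow) : ℕ :=
  let t := Dabs % e.p
  bif Nat.beq e.p 2 then
    (bif Nat.beq t 0 then e.tZero
     else bif (Nat.beq (Dabs % 8) 1 || Nat.beq (Dabs % 8) 7) then e.tPlus else e.tMinus)
  else
    let a := bif neg then (bif Nat.beq t 0 then 0 else e.p - t) else t
    let c := eulerCode3 a e.p
    bif Nat.beq c 1 then e.tPlus else bif Nat.beq c 0 then e.tZero else e.tMinus

/-- **`pick3 = pick2`.** [cite: MontgomeryVaughan2007, §9.3] -/
theorem pick3_eq (neg : Bool) (Dabs : ℕ) (e : PRow) : pick3 neg Dabs e = pick2 neg Dabs e := by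
  simp only [pick3, pick2, eulerCode3_eq_eulerCode]

/-- The prefix accumulator `rowSumK` with `pick3`. [cite: LuZamanZhao2026, §2.1 and (2.3)] -/
def rowSumK3 (neg : Bool) (Dabs : ℕ) : List PRow → ℕ → ℕ
  | [], acc => acc
  | e :: S, acc =>
    match acc + pick3 neg Dabs e with
    | 0 => rowSumK3 neg Dabs S 0
    | k + 1 => rowSumK3 neg Dabs S (k + 1)

/-- **`rowSumK3 = rowSumK`.** [cite: LuZamanZhao2026, §2.1 and (2.3)] -/
theorem rowSumK3_eq (neg : Bool) (Dabs : ℕ) :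
    ∀ (S : List PRow) (acc : ℕ), rowSumK3 neg Dabs S acc = rowSumK neg Dabs S acc
  | [], acc => by rw [rowSumK3, rowSumK]
  | e :: S, acc => by
    rw [rowSumK3, rowSumK, pick3_eq]
    cases acc + pick2 neg Dabs e with
    | zero => exact rowSumK3_eq neg Dabs S 0
    | succ k => exact rowSumK3_eq neg Dabs S (k + 1)

/-- Chaining decided segment accumulators (`rowSumK3` form of `rowSumK_append_eq`).
[cite: LuZamanZhao2026, §2.1 and (2.3)] -/
theorem rowSumK3_append_eq {neg : Bool} {Dabs : ℕ} {S T : List PRow} {a b c : ℕ}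
    (h₁ : rowSumK3 neg Dabs S a = b) (h₂ : rowSumK3 neg Dabs T b = c) :
    rowSumK3 neg Dabs (S ++ T) a = c := by
  rw [rowSumK3_eq] at h₁ h₂ ⊢
  exact rowSumK_append_eq h₁ h₂

/-- The stop-test search `rowSearch2` with `pick3`. [cite: LuZamanZhao2026, §2.1 and (2.5)] -/
def rowSearch3 (neg : Bool) (Dabs : ℕ) (hN : ℕ) : List PRow → ℕ → Bool
  | [], _ => false
  | e :: T, acc =>
    match acc + pick3 neg Dabs e with
    | 0 => rowSearch3 neg Dabs hN T 0
    | k + 1 => bif Nat.ble hN k then true else rowSearch3 neg Dabs hN T (k + 1)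

/-- **`rowSearch3 = rowSearch2`.** [cite: LuZamanZhao2026, §2.1 and (2.5)] -/
theorem rowSearch3_eq (neg : Bool) (Dabs hN : ℕ) :
    ∀ (T : List PRow) (acc : ℕ), rowSearch3 neg Dabs hN T acc = rowSearch2 neg Dabs hN T acc
  | [], acc => by rw [rowSearch3, rowSearch2]
  | e :: T, acc => by
    rw [rowSearch3, rowSearch2, pick3_eq]
    cases acc + pick2 neg Dabs e with
    | zero => exact rowSearch3_eq neg Dabs hN T 0
    | succ k =>
      show (bif Nat.ble hN k then true else rowSearch3 neg Dabs hN T (k + 1)) =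
        (bif Nat.ble hN k then true else rowSearch2 neg Dabs hN T (k + 1))
      rw [rowSearch3_eq neg Dabs hN T (k + 1)]

/-- The final-segment check `checkRowFromK` with `rowSearch3` (for `decide +kernel` on the deep tiers).
[cite: LuZamanZhao2026, §2.1 and (2.5)] -/
def checkRowFromK3 (T : List PRow) (neg : Bool) (Dabs acc : ℕ) : Bool :=
  match rI with
  | none => false
  | some R =>
    match rhsHi R Dabs with
    | some h => rowSearch3 neg Dabs h.toNat T acc
    | none => false

/-- `rowSearch3 = rowSearch2` as functions. [cite: LuZamanZhao2026, §2.1 and (2.5)] -/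
theorem rowSearch3_eq_rowSearch2 : rowSearch3 = rowSearch2 := by
  funext neg Dabs hN T acc
  exact rowSearch3_eq neg Dabs hN T acc

/-- **`checkRowFromK3 = checkRowFromK`.** [cite: LuZamanZhao2026, §2.1 and (2.5)] -/
theorem checkRowFromK3_eq (T : List PRow) (neg : Bool) (Dabs acc : ℕ) :
    checkRowFromK3 T neg Dabs acc = checkRowFromK T neg Dabs acc := by
  unfold checkRowFromK3 checkRowFromK
  cases rI with
  | none => rfl
  | some R =>
    dsimp only
    cases rhsHi R Dabs with
    | none => rfl
    | some h =>
      dsimp only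
      rw [rowSearch3_eq_rowSearch2]

/-- **Soundness of the segmented row check, three-piece form.** Over a valid table `S ++ T`: if `acc`
is the `rowSumK3`-accumulator of the prefix `S` and `checkRowFromK3` succeeds on the final segment `T`
from `acc`, then `D = sgnD neg |D|` is `CertifiedAt (1/5)` (Table-1 certificate, row `λ = 1.6`).
[cite: LuZamanZhao2026, §2.1–§3 and (2.5)] -/
theorem certifiedAt_of_checkRowFromK3 {S T : List PRow} (hT : TableValid (S ++ T)) {neg : Bool}
    {Dabs acc : ℕ} (hS : rowSumK3 neg Dabs S 0 = acc) (h : checkRowFromK3 T neg Dabs acc = true) :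
    CertifiedAt (1 / 5) (sgnD neg Dabs) := by
  rw [rowSumK3_eq] at hS
  rw [checkRowFromK3_eq] at h
  exact certifiedAt_of_checkRowFromK hT hS h

end Replay
end LuZamanZhao2026
end Literature.NumberTheory.LFunctions
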